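import Literature.NumberTheory.Transcendental.BakerField
import HarnessLib

/-!
# The `K`-models of the line derivations and chart polynomials: degrees and denominators

Topic: `Literature/NumberTheory/Transcendental`. Plan item W4/S4 (second sub-brick) of the unit
`provefact-Literature.NumberTheory.Transcendental.H-b596640137`. With the number field `K` of
`BakerField.lean`, the generic-coefficient models of `LineODEModel.lean` are instantiated with the
`K`-valued data (`BakerData.QK c m = genODEᵣ …`, `BakerData.HK c = HPolyᵣ …`) and PROVED to

* map to the complex objects: `map_QK` (`= genODE L κ c x_m`), `map_HK` (`= HPoly L κ c`);
* have total degree `≤ 2` (`totalDegree_QK_le`) — the hypothesis of `ArithPoly.word_bounds`;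
* have controlled denominators for `d₁ = 2·den`: `IsDenInt d₁ 3 (QK c m i)`, `IsDenInt d₁ 2 (HK c J)`
  (`isDenInt_QK`, `isDenInt_HK`), by walking the explicit formulas with the `IsDenInt` algebra of
  `ArithPoly.lean` (the coefficients are `x_k, x_b g₂/2, -x_b/2, κ_{eb} x_b, 2κ_{eb}x_b g₂, g₂/2, …`).

Sizes `‖·‖_σ` need no formula: they are bounded by finite sums over the (finite) index sets in
the sequel.

## References

* A. Baker, G. Wüstholz, *Logarithmic Forms and Diophantine Geometry*, CUP 2007, §6.8.
-/

noncomputable section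

open Complex MvPolynomial
open Literature.NumberTheory.Transcendental.ArithPoly
open scoped PeriodPair

namespace Literature.NumberTheory.Transcendental

/-! ### Small degree and denominator helpers -/

namespace ArithPoly

variable {K : Type*} [Field K] {ι : Type*}

/-- Numerals have total degree `0`. [folklore] -/
theorem totalDegree_ofNat (n : ℕ) [n.AtLeastTwo] :
    (OfNat.ofNat n : MvPolynomial ι K).totalDegree = 0 := by
  rw [← map_ofNat (C : K →+* MvPolynomial ι K) n, totalDegree_C]

/-- `deg (C a * p) ≤ deg p`. [folklore] -/
theorem totalDegree_C_mul_le (a : K) (p : MvPolynomial ι K) : (C a * p).totalDegree ≤ p.totalDegree := by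
  simpa [totalDegree_C] using totalDegree_mul (C a) p

/-- `deg (n * p) ≤ deg p` for a numeral `n`. [folklore] -/
theorem totalDegree_ofNat_mul_le (n : ℕ) [n.AtLeastTwo] (p : MvPolynomial ι K) :
    (OfNat.ofNat n * p).totalDegree ≤ p.totalDegree := by
  simpa [totalDegree_ofNat] using totalDegree_mul (OfNat.ofNat n : MvPolynomial ι K) p

/-- Numerals carry no denominator. [folklore] -/
theorem IsDenInt.ofNat (d : ℤ) (n : ℕ) [n.AtLeastTwo] : IsDenInt d 0 (OfNat.ofNat n : MvPolynomial ι K) := by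
  rw [← map_ofNat (MvPolynomial.C : K →+* MvPolynomial ι K) n]
  refine IsDenInt.C ?_
  have h : IsIntegral ℤ ((n : ℤ) : K) := isIntegral_intCast (B := K) n
  rw [Int.cast_natCast] at h
  rw [pow_zero, one_mul, ← Nat.cast_ofNat]
  exact h

/-- `1` carries no denominator. [folklore] -/
theorem IsDenInt.one (d : ℤ) : IsDenInt d 0 (1 : MvPolynomial ι K) := by
  rw [← MvPolynomial.C_1]; exact IsDenInt.C (by simpa using isIntegral_one)

/-- Products over finite sets: exponents add up (here with a uniform exponent `e`). [folklore] -/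
theorem IsDenInt.prod {α : Type*} {d : ℤ} {e : ℕ} (s : Finset α) {F : α → MvPolynomial ι K}
    (h : ∀ a ∈ s, IsDenInt d e (F a)) : IsDenInt d (s.card * e) (∏ a ∈ s, F a) := by
  classical
  induction s using Finset.induction_on with
  | empty => simpa using IsDenInt.one (ι := ι) (K := K) d
  | insert a s ha ih =>
    rw [Finset.prod_insert ha, Finset.card_insert_of_notMem ha, Nat.succ_mul, add_comm]
    exact (h a (Finset.mem_insert_self a s)).mul (ih fun b hb => h b (Finset.mem_insert_of_mem hb))

/-- Products with exponent `0` factors. [folklore] -/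
theorem IsDenInt.prod_zero {α : Type*} {d : ℤ} (s : Finset α) {F : α → MvPolynomial ι K}
    (h : ∀ a ∈ s, IsDenInt d 0 (F a)) : IsDenInt d 0 (∏ a ∈ s, F a) := by
  simpa using IsDenInt.prod s h

end ArithPoly

namespace GaGmE

namespace Std

namespace BakerData

variable {β γ δ : Type} [Fintype β] [Fintype γ] [Fintype δ] [DecidableEq γ]
variable (B : BakerData β γ δ)

/-- Integrality over `ℤ` in `K`, with the `ℤ`-algebra structure pinned to `Ring.toIntAlgebra` (the
one used by `ArithPoly.IsDenInt` and `AlgebraicGeneratorsField`; the intermediate field also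
carries the propositionally equal `IntermediateField.algebra'`). [folklore] -/
abbrev IntZ (x : B.K) : Prop := @IsIntegral ℤ B.K _ _ (Ring.toIntAlgebra _) x

/-! ### The `K`-valued coefficients and models -/

/-- `g₂ ∈ K`. [folklore] -/
abbrev g2K : B.K := B.gK' BIdx.g2
/-- `g₃ ∈ K`. [folklore] -/
abbrev g3K : B.K := B.gK' BIdx.g3
/-- `κ_{eb} ∈ K`. [folklore] -/
abbrev κK (e : δ) (b : γ) : B.K := B.gK' (BIdx.kap e b)
/-- the coordinates of the directions in `K`. [folklore] -/
abbrev xK (m : Fin B.dd) (k : β ⊕ (γ ⊕ δ)) : B.K := B.gK' (BIdx.dir m k)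

/-- **The `K`-model of the line derivation data** for the chart choice `c` and direction `x_m`.
[folklore] -/
def QK (c : γ → Bool) (m : Fin B.dd) : Gen β γ δ → MvPolynomial (Gen β γ δ) B.K :=
  genODEᵣ B.g2K B.g3K B.κK c (B.xK m)

/-- **The `K`-model of the chart polynomials** for the chart choice `c`. [folklore] -/
def HK (c : γ → Bool) : Option β × ThetaIdx γ δ → MvPolynomial (Gen β γ δ) B.K :=
  HPolyᵣ B.g2K B.g3K B.κK c

/-- `QK` maps to `genODE`. [folklore] -/
theorem map_QK (c : γ → Bool) (m : Fin B.dd) (i : Gen β γ δ) :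
    map B.emb (B.QK c m i) = genODE B.L B.κM c (B.xs m) i := by
  rw [QK, map_genODEᵣ]
  exact congrFun (genODEᵣ_complex B.L B.κM c (B.xs m)) i

/-- `HK` maps to `HPoly`. [folklore] -/
theorem map_HK (c : γ → Bool) (J : Option β × ThetaIdx γ δ) :
    map B.emb (B.HK c J) = HPoly B.L B.κM c J := by
  rw [HK, map_HPolyᵣ]
  exact congrFun (HPolyᵣ_complex (β := β) B.L B.κM c) J

/-! ### Degrees -/

section Deg

variable {R : Type*} [Field R]

omit [Fintype β] [Fintype γ] [Fintype δ] [DecidableEq γ] in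
/-- `deg X_k ≤ 1`. [folklore] -/
theorem degX (k : Gen β γ δ) : (X k : MvPolynomial (Gen β γ δ) R).totalDegree ≤ 1 := by
  rw [totalDegree_X]

omit [Fintype β] [Fintype γ] [Fintype δ] [DecidableEq γ] in
/-- `deg X_k² ≤ 2`. [folklore] -/
theorem degX2 (k : Gen β γ δ) : ((X k : MvPolynomial (Gen β γ δ) R) ^ 2).totalDegree ≤ 2 :=
  (totalDegree_pow _ _).trans (by have := degX (R := R) k; omega)

omit [Fintype β] [Fintype γ] [Fintype δ] [DecidableEq γ] in
/-- `deg (a X_k X_l) ≤ 2`. [folklore] -/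
theorem degCXX (a : R) (k l : Gen β γ δ) :
    (C a * X k * X l : MvPolynomial (Gen β γ δ) R).totalDegree ≤ 2 :=
  (totalDegree_mul _ _).trans (add_le_add ((totalDegree_C_mul_le _ _).trans (degX k)) (degX l))

omit [Fintype β] [Fintype γ] [Fintype δ] [DecidableEq γ] in
/-- The factor equations have degree `≤ 2`. [folklore] -/
theorem totalDegree_factorODEᵣ_le (g2 g3 : R) (lat : Bool) (b : γ) (i : Fin 2) :
    (factorODEᵣ (β := β) (δ := δ) g2 g3 lat b i).totalDegree ≤ 2 := by
  cases lat <;> fin_cases i <;>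
    simp only [factorODEᵣ, Bool.false_eq_true, if_false, if_true, Fin.zero_eta, Fin.mk_one, Fin.isValue,
      Matrix.cons_val_zero, Matrix.cons_val_one, Matrix.cons_val_fin_one]
  · exact (degX _).trans (by norm_num)
  · refine (totalDegree_sub _ _).trans (max_le ?_ (by rw [totalDegree_C]; norm_num))
    exact (totalDegree_ofNat_mul_le 6 _).trans (degX2 _)
  · refine (totalDegree_add _ _).trans (max_le ?_ ((totalDegree_C_mul_le _ _).trans (degX2 _)))
    rw [neg_mul, totalDegree_neg]
    exact (totalDegree_ofNat_mul_le 6 _).trans (degX2 _)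
  · refine (totalDegree_sub _ _).trans (max_le ((totalDegree_sub _ _).trans (max_le ?_ (degCXX _ _ _))) ?_)
    · rw [totalDegree_C]; norm_num
    · exact (totalDegree_C_mul_le _ _).trans (degX2 _)

omit [Fintype β] [Fintype γ] [Fintype δ] [DecidableEq γ] in
/-- The `ζ̂`-equations have degree `≤ 2`. [folklore] -/
theorem totalDegree_zetaHatODEᵣ_le (g2 g3 : R) (lat : Bool) (b : γ) :
    (zetaHatODEᵣ (β := β) (δ := δ) g2 g3 lat b).totalDegree ≤ 2 := by
  cases lat <;> simp only [zetaHatODEᵣ, Bool.false_eq_true, if_false, if_true]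
  · rw [totalDegree_neg]; exact (degX _).trans (by norm_num)
  · refine (totalDegree_sub _ _).trans (max_le ?_ (degCXX _ _ _))
    rw [neg_mul, totalDegree_neg]
    exact (totalDegree_C_mul_le _ _).trans (degX2 _)

omit [Fintype β] [Fintype δ] [DecidableEq γ] in
/-- **The line derivation data have degree `≤ 2`.** [folklore] -/
theorem totalDegree_genODEᵣ_le (g2 g3 : R) (κ : δ → γ → R) (c : γ → Bool) (x : β ⊕ (γ ⊕ δ) → R)
    (i : Gen β γ δ) : (genODEᵣ g2 g3 κ c x i).totalDegree ≤ 2 := by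
  rcases i with j | ⟨b, i⟩ | e
  · exact (totalDegree_C_mul_le _ _).trans ((degX _).trans (by norm_num))
  · exact (totalDegree_C_mul_le _ _).trans (totalDegree_factorODEᵣ_le _ _ _ _ _)
  · refine (totalDegree_sub _ _).trans (max_le (by rw [totalDegree_C]; norm_num) ?_)
    refine (totalDegree_finsetSum _ _).trans (Finset.sup_le fun b _ => ?_)
    exact (totalDegree_C_mul_le _ _).trans (totalDegree_zetaHatODEᵣ_le _ _ _ _)

end Deg

/-- `deg QK ≤ 2`. [folklore] -/
theorem totalDegree_QK_le (c : γ → Bool) (m : Fin B.dd) (i : Gen β γ δ) : (B.QK c m i).totalDegree ≤ 2 :=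
  totalDegree_genODEᵣ_le _ _ _ _ _ _

/-! ### Denominators -/

/-- The working denominator `d₁ = 2·den` (the explicit formulas involve halves). [folklore] -/
abbrev d₁ : ℤ := 2 * B.den

/-- `d₁ · (datum) ∈ 𝓞_K`. [folklore] -/
theorem isIntegral_d₁_mul_gK' (t : B.BIdx) : B.IntZ ((B.d₁ : B.K) * B.gK' t) := by
  have h := B.gens.isIntegral_den_mul_genK t
  have e : ((B.d₁ : ℤ) : B.K) * B.gK' t = (2 : B.K) * ((B.den : B.K) * B.gK' t) := by
    simp only [d₁, Int.cast_mul, Int.cast_ofNat]; ring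
  show IsIntegral ℤ _
  rw [e]
  exact (isIntegral_intCast (B := B.K) 2).mul h

/-- `d₁ · (datum / 2) ∈ 𝓞_K`. [folklore] -/
theorem isIntegral_d₁_mul_half_gK' (t : B.BIdx) : B.IntZ ((B.d₁ : B.K) * (B.gK' t / 2)) := by
  have h := B.gens.isIntegral_den_mul_genK t
  have e : ((B.d₁ : ℤ) : B.K) * (B.gK' t / 2) = (B.den : B.K) * B.gK' t := by
    simp only [d₁, Int.cast_mul, Int.cast_ofNat]; field_simp
  show IsIntegral ℤ _
  rwa [e]

/-- `d₁ · (n · datum / 2) ∈ 𝓞_K` for an integer `n`. [folklore] -/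
theorem isIntegral_d₁_mul_int_mul_half_gK' (n : ℤ) (t : B.BIdx) :
    B.IntZ ((B.d₁ : B.K) * (n * B.gK' t / 2)) := by
  have h := B.isIntegral_d₁_mul_half_gK' t
  have e : ((B.d₁ : ℤ) : B.K) * (n * B.gK' t / 2) = (n : B.K) * ((B.d₁ : B.K) * (B.gK' t / 2)) := by ring
  show IsIntegral ℤ _
  rw [e]
  exact (isIntegral_intCast (B := B.K) n).mul h

/-- `d₁ · (n · datum) ∈ 𝓞_K` for an integer `n`. [folklore] -/
theorem isIntegral_d₁_mul_int_mul_gK' (n : ℤ) (t : B.BIdx) :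
    B.IntZ ((B.d₁ : B.K) * (n * B.gK' t)) := by
  have e : ((B.d₁ : ℤ) : B.K) * (n * B.gK' t) = (n : B.K) * ((B.d₁ : B.K) * B.gK' t) := by ring
  show IsIntegral ℤ _
  rw [e]
  exact (isIntegral_intCast (B := B.K) n).mul (B.isIntegral_d₁_mul_gK' t)

/-- `d₁ · (-1/2) ∈ 𝓞_K`. [folklore] -/
theorem isIntegral_d₁_mul_neg_half : B.IntZ ((B.d₁ : B.K) * (-1 / 2)) := by
  have e : ((B.d₁ : ℤ) : B.K) * (-1 / 2) = ((-B.den : ℤ) : B.K) := by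
    simp only [d₁, Int.cast_mul, Int.cast_ofNat, Int.cast_neg]; field_simp
  show IsIntegral ℤ _
  rw [e]; exact isIntegral_intCast (B := B.K) _

/-- `d₁ · (1/2) ∈ 𝓞_K`. [folklore] -/
theorem isIntegral_d₁_mul_half : B.IntZ ((B.d₁ : B.K) * (1 / 2)) := by
  have e : ((B.d₁ : ℤ) : B.K) * (1 / 2) = ((B.den : ℤ) : B.K) := by
    simp only [d₁, Int.cast_mul, Int.cast_ofNat]; field_simp
  show IsIntegral ℤ _
  rw [e]; exact isIntegral_intCast (B := B.K) _

section DenHelpers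

variable {e : ℕ}

/-- A constant with denominator `d₁`. [folklore] -/
theorem isDenInt_C_of {a : B.K} (h : B.IntZ ((B.d₁ : B.K) * a)) :
    IsDenInt B.d₁ 1 (C a : MvPolynomial (Gen β γ δ) B.K) :=
  IsDenInt.C (by simpa using h)

/-- Variables. [folklore] -/
theorem isDenInt_X (k : Gen β γ δ) (e : ℕ) : IsDenInt B.d₁ e (X k : MvPolynomial (Gen β γ δ) B.K) :=
  (IsDenInt.X k).mono (Nat.zero_le e)

/-- Squares of variables. [folklore] -/
theorem isDenInt_X_sq (k : Gen β γ δ) (e : ℕ) : IsDenInt B.d₁ e ((X k : MvPolynomial (Gen β γ δ) B.K) ^ 2) := by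
  have := (IsDenInt.X (d := B.d₁) (K := B.K) k).pow 2
  exact this.mono (Nat.zero_le e)

end DenHelpers

/-- **`d₁ · factorODEᵣ` has integral coefficients.** [folklore] -/
theorem isDenInt_factorODEᵣ (lat : Bool) (b : γ) (i : Fin 2) :
    IsDenInt B.d₁ 1 (factorODEᵣ (β := β) (δ := δ) B.g2K B.g3K lat b i) := by
  have hg2h : IsDenInt B.d₁ 1 (C (B.g2K / 2) : MvPolynomial (Gen β γ δ) B.K) :=
    B.isDenInt_C_of (B.isIntegral_d₁_mul_half_gK' _)
  have hg2 : IsDenInt B.d₁ 1 (C B.g2K : MvPolynomial (Gen β γ δ) B.K) :=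
    B.isDenInt_C_of (B.isIntegral_d₁_mul_gK' _)
  have hg3h : IsDenInt B.d₁ 1 (C (3 * B.g3K / 2) : MvPolynomial (Gen β γ δ) B.K) :=
    B.isDenInt_C_of (by simpa using B.isIntegral_d₁_mul_int_mul_half_gK' 3 BIdx.g3)
  have hhalf : IsDenInt B.d₁ 1 (C (-1 / 2) : MvPolynomial (Gen β γ δ) B.K) :=
    B.isDenInt_C_of B.isIntegral_d₁_mul_neg_half
  have h6 : IsDenInt B.d₁ 1 (6 : MvPolynomial (Gen β γ δ) B.K) := (IsDenInt.ofNat _ 6).mono (Nat.zero_le 1)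
  cases lat <;> fin_cases i <;>
    simp only [factorODEᵣ, Bool.false_eq_true, if_false, if_true, Fin.zero_eta, Fin.mk_one, Fin.isValue,
      Matrix.cons_val_zero, Matrix.cons_val_one, Matrix.cons_val_fin_one]
  · exact B.isDenInt_X _ 1
  · exact (h6.mul (B.isDenInt_X_sq _ 0)).sub hg2h
  · rw [neg_mul]
    exact (h6.mul (B.isDenInt_X_sq _ 0)).neg.add (hg2h.mul (B.isDenInt_X_sq _ 0))
  · exact (hhalf.sub ((hg2.mul (B.isDenInt_X _ 0)).mul (B.isDenInt_X _ 0))).sub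
      (hg3h.mul (B.isDenInt_X_sq _ 0))

/-- **`d₁ · zetaHatODEᵣ` has integral coefficients.** [folklore] -/
theorem isDenInt_zetaHatODEᵣ (lat : Bool) (b : γ) :
    IsDenInt B.d₁ 1 (zetaHatODEᵣ (β := β) (δ := δ) B.g2K B.g3K lat b) := by
  have h2g2 : IsDenInt B.d₁ 1 (C (2 * B.g2K) : MvPolynomial (Gen β γ δ) B.K) :=
    B.isDenInt_C_of (by simpa using B.isIntegral_d₁_mul_int_mul_gK' 2 BIdx.g2)
  have h3g3 : IsDenInt B.d₁ 1 (C (3 * B.g3K) : MvPolynomial (Gen β γ δ) B.K) :=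
    B.isDenInt_C_of (by simpa using B.isIntegral_d₁_mul_int_mul_gK' 3 BIdx.g3)
  cases lat <;> simp only [zetaHatODEᵣ, Bool.false_eq_true, if_false, if_true]
  · exact (B.isDenInt_X _ 1).neg
  · rw [neg_mul]
    exact (h2g2.mul (B.isDenInt_X_sq _ 0)).neg.sub ((h3g3.mul (B.isDenInt_X _ 0)).mul (B.isDenInt_X _ 0))

/-- **`d₁³ · QK` has integral coefficients.** [folklore] -/
theorem isDenInt_QK (c : γ → Bool) (m : Fin B.dd) (i : Gen β γ δ) : IsDenInt B.d₁ 3 (B.QK c m i) := by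
  have hx : ∀ k, IsDenInt B.d₁ 1 (C (B.xK m k) : MvPolynomial (Gen β γ δ) B.K) := fun k =>
    B.isDenInt_C_of (B.isIntegral_d₁_mul_gK' _)
  have hκx : ∀ e b, IsDenInt B.d₁ 2 (C (B.κK e b * B.xK m (iz b)) : MvPolynomial (Gen β γ δ) B.K) := by
    intro e b
    rw [C_mul]
    exact (B.isDenInt_C_of (B.isIntegral_d₁_mul_gK' _)).mul (hx _)
  rcases i with j | ⟨b, i⟩ | e
  · exact ((hx _).mul (B.isDenInt_X _ 0)).mono (by norm_num)
  · exact ((hx _).mul (B.isDenInt_factorODEᵣ _ _ _)).mono (by norm_num)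
  · show IsDenInt B.d₁ 3 (C (B.xK m (is e)) - ∑ b, C (B.κK e b * B.xK m (iz b)) * zetaHatODEᵣ B.g2K B.g3K (c b) b)
    exact ((hx _).mono (by norm_num)).sub (IsDenInt.sum fun b _ => (hκx e b).mul (B.isDenInt_zetaHatODEᵣ _ _))

/-- `rPolyᵣ` carries no denominator. [folklore] -/
theorem isDenInt_rPolyᵣ (lat : Bool) (b : γ) (i : Fin 3) :
    IsDenInt B.d₁ 0 (rPolyᵣ (β := β) (δ := δ) (R := B.K) lat b i) := by
  cases lat <;> fin_cases i <;>
    simp only [rPolyᵣ, Bool.false_eq_true, if_false, if_true, Fin.zero_eta, Fin.mk_one, Fin.isValue,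
      Fin.reduceFinMk, Matrix.cons_val_zero, Matrix.cons_val_one, Matrix.cons_val] <;>
    first | exact IsDenInt.one _ | exact IsDenInt.X _

/-- **`d₁ · corrPolyᵣ` has integral coefficients.** [folklore] -/
theorem isDenInt_corrPolyᵣ (lat : Bool) (b : γ) (i : Fin 3) :
    IsDenInt B.d₁ 1 (corrPolyᵣ (β := β) (δ := δ) B.g2K B.g3K lat b i) := by
  have hg2h : IsDenInt B.d₁ 1 (C (B.g2K / 2) : MvPolynomial (Gen β γ δ) B.K) :=
    B.isDenInt_C_of (B.isIntegral_d₁_mul_half_gK' _)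
  have hg3h : IsDenInt B.d₁ 1 (C (B.g3K / 2) : MvPolynomial (Gen β γ δ) B.K) :=
    B.isDenInt_C_of (B.isIntegral_d₁_mul_half_gK' _)
  have hhalf : IsDenInt B.d₁ 1 (C (1 / 2) : MvPolynomial (Gen β γ δ) B.K) :=
    B.isDenInt_C_of B.isIntegral_d₁_mul_half
  have h2 : IsDenInt B.d₁ 1 (2 : MvPolynomial (Gen β γ δ) B.K) := (IsDenInt.ofNat _ 2).mono (Nat.zero_le 1)
  cases lat <;> fin_cases i <;>
    simp only [corrPolyᵣ, Bool.false_eq_true, if_false, if_true, Fin.zero_eta, Fin.mk_one, Fin.isValue,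
      Fin.reduceFinMk, Matrix.cons_val_zero, Matrix.cons_val_one, Matrix.cons_val]
  · exact IsDenInt.zero
  · exact IsDenInt.zero
  · exact h2.mul (B.isDenInt_X_sq _ 0)
  · rw [neg_mul]
    exact (h2.mul (B.isDenInt_X_sq _ 0)).neg
  · exact (hhalf.neg.sub ((hg2h.mul (B.isDenInt_X _ 0)).mul (B.isDenInt_X _ 0))).sub
      (hg3h.mul (B.isDenInt_X_sq _ 0))
  · exact IsDenInt.zero

/-- `TPolyᵣ` carries no denominator. [folklore] -/
theorem isDenInt_TPolyᵣ (a : Option β) : IsDenInt B.d₁ 0 (TPolyᵣ (γ := γ) (δ := δ) (R := B.K) a) := by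
  cases a
  · exact IsDenInt.one _
  · exact IsDenInt.X _

/-- **`d₁² · HK` has integral coefficients.** [folklore] -/
theorem isDenInt_HK (c : γ → Bool) (J : Option β × ThetaIdx γ δ) : IsDenInt B.d₁ 2 (B.HK c J) := by
  have hprod : ∀ (M : γ → Fin 3) (s : Finset γ),
      IsDenInt B.d₁ 0 (∏ b ∈ s, rPolyᵣ (β := β) (δ := δ) (R := B.K) (c b) b (M b)) := fun M s =>
    IsDenInt.prod_zero s fun b _ => B.isDenInt_rPolyᵣ _ _ _
  rcases J with ⟨a, M, _ | e⟩
  · show IsDenInt B.d₁ 2 (TPolyᵣ a * ∏ b, rPolyᵣ (c b) b (M b))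
    exact ((B.isDenInt_TPolyᵣ a).mul (hprod M Finset.univ)).mono (by norm_num)
  · show IsDenInt B.d₁ 2 (TPolyᵣ a * (X (Sum.inr (Sum.inr e)) * ∏ b, rPolyᵣ (c b) b (M b) -
        ∑ b, C (B.κK e b) * (corrPolyᵣ B.g2K B.g3K (c b) b (M b) *
          ∏ b' ∈ Finset.univ.erase b, rPolyᵣ (c b') b' (M b'))))
    refine ((B.isDenInt_TPolyᵣ a).mul (IsDenInt.sub (e := 2) ?_ ?_)).mono (by norm_num)
    · exact ((B.isDenInt_X _ 0).mul (hprod M Finset.univ)).mono (by norm_num)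
    · exact IsDenInt.sum fun b _ =>
        (B.isDenInt_C_of (B.isIntegral_d₁_mul_gK' _)).mul
          ((B.isDenInt_corrPolyᵣ _ _ _).mul (hprod M _))

end BakerData

end Std

end GaGmE

end Literature.NumberTheory.Transcendental

end
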